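import Literature.Analysis.FluidPDE.HardSphereCollisionTimeMeasurable
import HarnessLib

/-!
# Busy particles of a window: double counting of collisions and measurability

For a hard-sphere trajectory `γ` (binary collisions: at each collision time exactly the two
particles of the colliding pair participate, `IsHardSphereTrajectory.participates_iff`) and a set
of times `W` meeting finitely many collision times, the collision counts of the particles add up to
twice the number of collisions (`IsHardSphereTrajectory.sum_ncard_collisionTimesOf_inter_eq`:
`∑ₖ #(collision times of k in W) = 2 · #(collision times in W)`), so that the number of BUSY
particles — those with more than `K` collisions in `W` — is at most `2 · #(collisions in W) / (K+1)`
(`IsHardSphereTrajectory.succ_mul_card_filter_lt_ncard_le`, a Markov-type count; flow versions on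
the good set for the window `(0, h]`, `HardSphereFlow.succ_mul_busyCard_le`,
`HardSphereFlow.succ_mul_busyCard_le_numCollisions`).  This is the first-moment bookkeeping behind
"stop each particle at its `K`-th collision of a short window" (Gallagher–Saint-Raymond–Texier 2013
§4.1–4.2, Prop. 4.1.1: a.e. finitely many collisions, enumerated; Cercignani–Illner–Pulvirenti 1994
App. 4.A: the mean number of collisions of a window is the collision flux; Kipnis–Landim 1999
App. 1 §5–6 for the clamping paradigm): combined with a bound on the mean number of collisions it
bounds the MEAN number of busy particles.

Measurability (`HardSphereFlow.measurable_busyCard_comp_subtype`, `HardSphereFlow.measurable_busyCard`,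
torus specialisations `…_torus`): the number of particles with more than `K` collisions in `(0, h]`
is a measurable function on the good set (chain form of the event,
`HardSphereFlow.measurableSet_lt_ncard_collisionTimesOf_window`), and its guarded extension by the
clause `z ∈ Φ.good` is measurable on phase space (the good set is measurable, so images of
measurable subsets of the good subtype are measurable).

No new definitions: the busy count is written inline as
`(Finset.univ.filter fun k => K < (collisionTimesOf G ε γ k ∩ W).ncard).card`.

## References

* I. Gallagher, L. Saint-Raymond, B. Texier, *From Newton to Boltzmann* (2013), §4.1–4.2.  [GST2013]
* C. Cercignani, R. Illner, M. Pulvirenti, *The Mathematical Theory of Dilute Gases* (1994),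
  App. 4.A.  [CIPDiluteGases1994]
* C. Kipnis, C. Landim, *Scaling Limits of Interacting Particle Systems* (1999), App. 1 §5–6.
-/

open Set Function MeasureTheory Filter
open scoped ENNReal

namespace Literature.Analysis.FluidPDE

noncomputable section

/-! ## Along a hard-sphere trajectory: double counting -/

section Trajectory

variable {d : Type*} [Fintype d] {X : Type*} [TopologicalSpace X] {N : ℕ} {G : Geometry d X}
  {ε : ℝ} {γ : ℝ → Config N d X}

namespace IsHardSphereTrajectory

open scoped Classical in
/-- **Binary collisions**: at a collision time of a hard-sphere trajectory exactly two particles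
participate. [folklore] -/
theorem card_filter_participates_eq_two (h : IsHardSphereTrajectory G ε N γ) {t : ℝ}
    (ht : t ∈ collisionTimes G ε γ) :
    (Finset.univ.filter fun k => Participates G ε (γ t) k).card = 2 := by
  classical
  obtain ⟨⟨p, q⟩, hp⟩ := mem_collisionTimes_iff_contactPairs_nonempty.1 ht
  have hpq : p ≠ q := (mem_contactPairs.1 hp).1
  have hset : (Finset.univ.filter fun k => Participates G ε (γ t) k) = {p, q} := by
    ext k
    simp only [Finset.mem_filter, Finset.mem_univ, true_and, Finset.mem_insert,
      Finset.mem_singleton]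
    exact h.participates_iff hp
  rw [hset, Finset.card_pair hpq]

omit [TopologicalSpace X] in
/-- The collision times of particle `k` in `W` are the collision times `t ∈ W` at which `k`
participates (finset form, for `W` meeting finitely many collision times). [folklore] -/
theorem collisionTimesOf_inter_eq_coe_filter {W : Set ℝ} (hW : (collisionTimes G ε γ ∩ W).Finite)
    (k : Fin N) [DecidablePred fun t => Participates G ε (γ t) k] :
    collisionTimesOf G ε γ k ∩ W = ↑(hW.toFinset.filter fun t => Participates G ε (γ t) k) := by
  ext t
  simp only [Finset.coe_filter, Set.Finite.mem_toFinset, mem_inter_iff, mem_setOf_eq]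
  constructor
  · rintro ⟨hk, hw⟩
    exact ⟨⟨collisionTimesOf_subset γ k hk, hw⟩, hk⟩
  · rintro ⟨⟨-, hw⟩, hk⟩
    exact ⟨hk, hw⟩

/-- **Double counting of collisions.** Along a hard-sphere trajectory, for a set of times `W`
meeting finitely many collision times, the collision counts of the particles in `W` add up to twice
the number of collision times in `W` (each collision has exactly two participants). [folklore] -/
theorem sum_ncard_collisionTimesOf_inter_eq (h : IsHardSphereTrajectory G ε N γ) {W : Set ℝ}
    (hW : (collisionTimes G ε γ ∩ W).Finite) :
    ∑ k, (collisionTimesOf G ε γ k ∩ W).ncard = 2 * (collisionTimes G ε γ ∩ W).ncard := by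
  classical
  have hk : ∀ k, (collisionTimesOf G ε γ k ∩ W).ncard =
      ∑ t ∈ hW.toFinset, if Participates G ε (γ t) k then 1 else 0 := by
    intro k
    rw [collisionTimesOf_inter_eq_coe_filter hW k, Set.ncard_coe_finset, Finset.card_filter]
  simp_rw [hk]
  rw [Finset.sum_comm, Set.ncard_eq_toFinset_card _ hW, Finset.card_eq_sum_ones, Finset.mul_sum]
  refine Finset.sum_congr rfl fun t ht => ?_
  rw [← Finset.card_filter, h.card_filter_participates_eq_two (hW.mem_toFinset.1 ht).1, mul_one]

/-- **Few busy particles, counting form.** Along a hard-sphere trajectory, for a set of times `W`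
meeting finitely many collision times and a threshold `K`, `(K + 1) · #{k | K < #(collision times
of k in W)} ≤ 2 · #(collision times in W)`. [folklore] -/
theorem succ_mul_card_filter_lt_ncard_le (h : IsHardSphereTrajectory G ε N γ) {W : Set ℝ}
    (hW : (collisionTimes G ε γ ∩ W).Finite) (K : ℕ) :
    (K + 1) * (Finset.univ.filter fun k => K < (collisionTimesOf G ε γ k ∩ W).ncard).card ≤
      2 * (collisionTimes G ε γ ∩ W).ncard := by
  classical
  rw [← h.sum_ncard_collisionTimesOf_inter_eq hW, mul_comm, Finset.card_eq_sum_ones,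
    Finset.sum_mul, one_mul]
  calc ∑ _k ∈ Finset.univ.filter (fun k => K < (collisionTimesOf G ε γ k ∩ W).ncard), (K + 1)
      ≤ ∑ k ∈ Finset.univ.filter (fun k => K < (collisionTimesOf G ε γ k ∩ W).ncard),
          (collisionTimesOf G ε γ k ∩ W).ncard :=
        Finset.sum_le_sum fun k hk => Nat.succ_le_of_lt (Finset.mem_filter.1 hk).2
    _ ≤ ∑ k, (collisionTimesOf G ε γ k ∩ W).ncard :=
        Finset.sum_le_sum_of_subset_of_nonneg (Finset.filter_subset _ _) fun _ _ _ => Nat.zero_le _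

end IsHardSphereTrajectory

end Trajectory

/-! ## Along a hard-sphere flow, on the good set -/

section Kinetic

variable {d : Type*} [Fintype d] {X : Type*} [MeasureSpace X] [TopologicalSpace X] {N : ℕ}
  {G : Geometry d X} {ε : ℝ}

namespace HardSphereFlow

variable (Φ : HardSphereFlow G ε N)

/-- **Few busy particles in the window `(0, h]`, counting form, along a flow**: on the good set,
`(K + 1) · #{i | K < #(collision times of i in (0, h])} ≤ 2 · #(collision times in (0, h])`.
[folklore] -/
theorem succ_mul_busyCard_le {z : Config N d X} (hz : z ∈ Φ.good) (K : ℕ) (h : ℝ) :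
    (K + 1) * (Finset.univ.filter fun i =>
        K < (collisionTimesOf G ε (fun s => Φ.flow s z) i ∩ Ioc 0 h).ncard).card ≤
      2 * (collisionTimes G ε (fun s => Φ.flow s z) ∩ Ioc 0 h).ncard :=
  (Φ.isTrajectory z hz).succ_mul_card_filter_lt_ncard_le
    (((Φ.isTrajectory z hz).locFinite 0 h).subset (inter_subset_inter_right _ Ioc_subset_Icc_self)) K

/-- The same with the closed window: on the good set,
`(K + 1) · #{i | K < #(collision times of i in (0, h])} ≤ 2 · numCollisions 0 h`
(`numCollisions` counts the collision times of `[0, h]`). [folklore] -/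
theorem succ_mul_busyCard_le_numCollisions {z : Config N d X} (hz : z ∈ Φ.good) (K : ℕ) (h : ℝ) :
    (K + 1) * (Finset.univ.filter fun i =>
        K < (collisionTimesOf G ε (fun s => Φ.flow s z) i ∩ Ioc 0 h).ncard).card ≤
      2 * numCollisions G ε (fun s => Φ.flow s z) 0 h := by
  refine (Φ.succ_mul_busyCard_le hz K h).trans (Nat.mul_le_mul_left 2 ?_)
  exact Set.ncard_le_ncard (inter_subset_inter_right _ Ioc_subset_Icc_self)
    ((Φ.isTrajectory z hz).locFinite 0 h)

/-- `ℝ≥0∞` form of the counting bound (the form integrated against a law on phase space): on the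
good set, `#{busy} · (K + 1) ≤ 2 · numCollisions 0 h` as extended non-negative reals. [folklore] -/
theorem busyCard_mul_succ_le_ennreal {z : Config N d X} (hz : z ∈ Φ.good) (K : ℕ) (h : ℝ) :
    ((Finset.univ.filter fun i =>
        K < (collisionTimesOf G ε (fun s => Φ.flow s z) i ∩ Ioc 0 h).ncard).card : ℝ≥0∞) *
        ((K : ℝ≥0∞) + 1) ≤
      2 * (numCollisions G ε (fun s => Φ.flow s z) 0 h : ℝ≥0∞) := by
  have h1 := Φ.succ_mul_busyCard_le_numCollisions hz K h
  rw [mul_comm]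
  exact_mod_cast h1

/-! ### Measurability of the busy count -/

/-- **The number of busy particles is measurable on the good set** (continuous separation distance,
measurable separation map): `z ↦ #{i | K < #(collision times of i in (0, h])}` is a measurable
`ℕ`-valued function on `Φ.good`. [folklore] -/
theorem measurable_busyCard_comp_subtype
    (hGc : Continuous fun p : X × X => ‖G.sepVec p.1 p.2‖)
    (hGm : Measurable fun p : X × X => G.sepVec p.1 p.2) (K : ℕ) (h : ℝ) :
    Measurable fun z : Φ.good => (Finset.univ.filter fun i =>
      K < (collisionTimesOf G ε (fun s => Φ.flow s (z : Config N d X)) i ∩ Ioc 0 h).ncard).card := by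
  classical
  have hset : ∀ i, MeasurableSet {z : Φ.good |
      K < (collisionTimesOf G ε (fun s => Φ.flow s (z : Config N d X)) i ∩ Ioc 0 h).ncard} :=
    fun i => Φ.measurableSet_lt_ncard_collisionTimesOf_window hGc hGm i h K
  have heq : (fun z : Φ.good => (Finset.univ.filter fun i =>
      K < (collisionTimesOf G ε (fun s => Φ.flow s (z : Config N d X)) i ∩ Ioc 0 h).ncard).card) =
      fun z : Φ.good => ∑ i, if K < (collisionTimesOf G ε (fun s => Φ.flow s (z : Config N d X)) i ∩
        Ioc 0 h).ncard then 1 else 0 := by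
    funext z
    exact Finset.card_filter _ _
  rw [heq]
  refine Finset.measurable_sum _ fun i _ => ?_
  exact Measurable.ite (hset i) measurable_const measurable_const

/-- **The guarded busy count is measurable on phase space**: with the clause `z ∈ Φ.good` added to
the busy predicate (so that the count vanishes off the good set),
`z ↦ #{i | z ∈ Φ.good ∧ K < #(collision times of i in (0, h])}` is measurable (the good set is
measurable; images of measurable subsets of the good subtype are measurable). [folklore] -/
theorem measurable_busyCard
    (hGc : Continuous fun p : X × X => ‖G.sepVec p.1 p.2‖)
    (hGm : Measurable fun p : X × X => G.sepVec p.1 p.2) (K : ℕ) (h : ℝ)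
    [∀ z : Config N d X, ∀ i, Decidable (z ∈ Φ.good ∧
      K < (collisionTimesOf G ε (fun s => Φ.flow s z) i ∩ Ioc 0 h).ncard)] :
    Measurable fun z : Config N d X => (Finset.univ.filter fun i => z ∈ Φ.good ∧
      K < (collisionTimesOf G ε (fun s => Φ.flow s z) i ∩ Ioc 0 h).ncard).card := by
  classical
  have hset : ∀ i, MeasurableSet {z : Config N d X | z ∈ Φ.good ∧
      K < (collisionTimesOf G ε (fun s => Φ.flow s z) i ∩ Ioc 0 h).ncard} := by
    intro i
    have himage : {z : Config N d X | z ∈ Φ.good ∧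
        K < (collisionTimesOf G ε (fun s => Φ.flow s z) i ∩ Ioc 0 h).ncard} =
        Subtype.val '' {z : Φ.good |
          K < (collisionTimesOf G ε (fun s => Φ.flow s (z : Config N d X)) i ∩ Ioc 0 h).ncard} := by
      ext z
      simp only [mem_setOf_eq, mem_image, Subtype.exists, exists_and_right, exists_eq_right]
      constructor
      · rintro ⟨hz, hK⟩
        exact ⟨hz, hK⟩
      · rintro ⟨hz, hK⟩
        exact ⟨hz, hK⟩
    rw [himage]
    exact Φ.measurableSet_good.subtype_image
      (Φ.measurableSet_lt_ncard_collisionTimesOf_window hGc hGm i h K)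
  have heq : (fun z : Config N d X => (Finset.univ.filter fun i => z ∈ Φ.good ∧
      K < (collisionTimesOf G ε (fun s => Φ.flow s z) i ∩ Ioc 0 h).ncard).card) =
      fun z => ∑ i, if z ∈ Φ.good ∧ K < (collisionTimesOf G ε (fun s => Φ.flow s z) i ∩
        Ioc 0 h).ncard then 1 else 0 := by
    funext z
    rw [Finset.card_filter]
  rw [heq]
  refine Finset.measurable_sum _ fun i _ => ?_
  exact Measurable.ite (hset i) measurable_const measurable_const

end HardSphereFlow

end Kinetic

/-! ## The flat torus -/

section TorusGeometry

variable {d : Type*} [Fintype d] {N : ℕ} {ε : ℝ}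

/-- On `𝕋^d`: the number of busy particles of the window `(0, h]` is measurable on the good set.
[folklore] -/
theorem HardSphereFlow.measurable_busyCard_comp_subtype_torus
    (Φ : HardSphereFlow (Torus.geometry d) ε N) (K : ℕ) (h : ℝ) :
    Measurable fun z : Φ.good => (Finset.univ.filter fun i =>
      K < (collisionTimesOf (Torus.geometry d) ε
        (fun s => Φ.flow s (z : Config N d (UnitAddTorus d))) i ∩ Ioc 0 h).ncard).card :=
  Φ.measurable_busyCard_comp_subtype
    (Torus.continuous_norm_reprSym.comp (continuous_fst.sub continuous_snd))
    Torus.measurable_geometry_sepVec K h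

/-- On `𝕋^d`: the guarded busy count of the window `(0, h]` is measurable on phase space.
[folklore] -/
theorem HardSphereFlow.measurable_busyCard_torus (Φ : HardSphereFlow (Torus.geometry d) ε N)
    (K : ℕ) (h : ℝ)
    [∀ z : Config N d (UnitAddTorus d), ∀ i, Decidable (z ∈ Φ.good ∧
      K < (collisionTimesOf (Torus.geometry d) ε (fun s => Φ.flow s z) i ∩ Ioc 0 h).ncard)] :
    Measurable fun z : Config N d (UnitAddTorus d) => (Finset.univ.filter fun i => z ∈ Φ.good ∧
      K < (collisionTimesOf (Torus.geometry d) ε (fun s => Φ.flow s z) i ∩ Ioc 0 h).ncard).card :=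
  Φ.measurable_busyCard (Torus.continuous_norm_reprSym.comp (continuous_fst.sub continuous_snd))
    Torus.measurable_geometry_sepVec K h

end TorusGeometry

end

end Literature.Analysis.FluidPDE
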